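import Literature.MathematicalPhysics.KineticTheory.ShortFlightCharging
import HarnessLib

/-!
# The short-flight count of a hard-sphere gas under an invariant law (window bound, rung 0)

Topic `Literature/MathematicalPhysics/KineticTheory` (wanted by the crux line `even-rung-mean-variance` of
`JParityClosure.EvenStressEnskog`, stmt-AtomisticToContinuum-13079: residuals `(S2b₂)` (short-flight deficit)
and the continuity correction of the collision-cylinder pull-back).

For `N + 1` hard spheres of diameter `ε = hsDiameter σ N` on `𝕋³` under the homogeneous (rung-0) local
Gibbs law `G_N = posGibbs ⊗ N(u,θ)^{⊗(N+1)}`, preserved by the hard-sphere flow `Φ` (`hstat`), the number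
of ordered collisions `(s, i, j)`, `s ∈ [0, τ]`, of a good orbit that are PRECEDED BY ANOTHER COLLISION OF A
PARTNER WITHIN TIME `ℓ` (pair flight start `> s − ℓ`; this includes the collisions before time `ℓ`) is
small in probability, with a bound LINEAR IN `ℓ`:

`G_N{z good, #short ≥ y} ≤ y⁻¹ ℓ · (48 (N+1)²ε² m₁ + 192 τ (N+1)²ε² m₂ + 1536 τ (N+1)³ ε⁴ m₂)`
(`localGibbsLaw_shortFlightCount_ge_le`; `m₁ = E‖w − v‖`, `m₂ = E‖w − v‖²` for two independent
`N(u,θ)` velocities).  With `(N+1)ε³ = σ³`, `ℓ = κ ε` and `y ≍ (N+1)/ε` this is `O(κ)` uniformly in `N`.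

Proof: the pathwise charging `#short ≤ K₁ + K₃ + 2 K_F` of `ShortFlightCharging`; `K₁` (collisions
before time `ℓ`) and `K₃` (velocity mark `‖w − v‖/R`, `R = (1/2 − ε)/ℓ`) are controlled by the
collision-flux bound `localGibbsLaw_collisionMarkSum_ge_le`; the collision sum `K_F` of the
FORWARD-CONTACT COUNT `F(w,p,m) = #{j' ∉ {p,m} on a free collision course with p within time ℓ}` by the
abstract window bound `measure_collisionSum_ge_le_liminf` with the THREE-LABEL statics
`localGibbsLaw_fwdHitCollisionSum_ge_le`: along the backward free flight of duration `≤ h = τ/M` of the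
window the forward tube of `p` of length `ℓ` stays inside the two-sided tube of length `ℓ + h`
(`exists_latticeVec_mem_twoSidedTube`), so `F ≤ F̃_M = #{j' : a lift of x_{j'} − x_p lies in the two-sided
swept tube}`; and `G_N(window(p,m) ∧ j' ∈ tube(p)) ≤ 8 · 4ε²h‖v_p − v_m‖ · 4ε²(ℓ + h)‖v_p − v_{j'}‖`
integrated against the Gaussian velocities (`measure_windowEvent_inter_tubeEvent_le`, from a Ruelle-type
three-label bound `htriple`, the swept-tube volumes `htube` and the minimal-image lift inequality `hlift`,
all supplied by the consumer as in `CollisionFluxUpperBound`), whence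
`M · E[W_M] ≤ 128 (N+1)³ ε⁴ τ (ℓ + τ/M) m₂ → 256 (N+1)³ ε⁵ … ` — the mesh cancels.
(Cercignani–Illner–Pulvirenti 1994, App. 4.A; Gallagher–Saint-Raymond–Texier 2013, Prop. 4.1.1.)

## References

* C. Cercignani, R. Illner, M. Pulvirenti, *The Mathematical Theory of Dilute Gases* (1994), §2.2,
  App. 4.A.  [CIPDiluteGases1994]
* I. Gallagher, L. Saint-Raymond, B. Texier, *From Newton to Boltzmann* (2013), Prop. 4.1.1.  [GST2013]
* D. Ruelle, *Statistical Mechanics: Rigorous Results* (1969), §4.2.  [Ruelle1969]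
-/

noncomputable section

open MeasureTheory Set Filter Topology
open scoped ENNReal InnerProductSpace BigOperators Classical

namespace Literature.MathematicalPhysics.KineticTheory

open Literature.Analysis.FluidPDE Literature.Analysis.FunctionSpaces

/-! ## Geometry: the forward tube along a backward free flight lies in the two-sided tube -/

/-- **Forward contact after a backward free flight puts a lift in the two-sided swept tube.**  Let `w`
not overlap at diameter `ε`, `t ∈ [0, h]`, and suppose that in the configuration `S_{−t} w` the pair
`(j', p)` flying freely comes to contact at a forward time `t' ∈ (0, ℓ)`:
`‖reprSym((x'_{j'} − x'_p) + proj(t' (v_{j'} − v_p)))‖ = ε`.  Then some lattice translate of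
`reprSym(x_{j'} − x_p)` lies in `S_ℓ(v_{j'} − v_p) ∪ S_h(v_p − v_{j'})`, for any swept-tube families
`S_ℓ`, `S_h` with the covering properties `hSℓ`, `hSh` (contact within forward time `ℓ`, resp. `h`).
[folklore] -/
theorem exists_latticeVec_mem_twoSidedTube {N : ℕ} {ε h ℓ : ℝ} {Sh Sℓ : V3 → Set V3}
    (hSh : ∀ (u r : V3) (s : ℝ), ε ≤ ‖r‖ → s ∈ Icc 0 h → ‖r + s • u‖ = ε → r ∈ Sh u)
    (hSℓ : ∀ (u r : V3) (s : ℝ), ε ≤ ‖r‖ → s ∈ Icc 0 ℓ → ‖r + s • u‖ = ε → r ∈ Sℓ u)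
    {w : Config N (Fin 3) T3} (hw : w ∈ hardSphereDomain (Torus.geometry (Fin 3)) N ε)
    {p j' : Fin N} (hj'p : j' ≠ p) {t : ℝ} (ht : t ∈ Icc 0 h) {t' : ℝ} (ht' : t' ∈ Ioo 0 ℓ)
    (hc : ‖Torus.reprSym ((((freeFlight (Torus.geometry (Fin 3)) (-t) w) j').1 -
        ((freeFlight (Torus.geometry (Fin 3)) (-t) w) p).1) +
        Torus.proj (t' • (((freeFlight (Torus.geometry (Fin 3)) (-t) w) j').2 -
          ((freeFlight (Torus.geometry (Fin 3)) (-t) w) p).2)))‖ = ε) :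
    ∃ k : Fin 3 → ℤ, Torus.reprSym ((w j').1 - (w p).1) + Torus.latticeVec k ∈
      Sℓ ((w j').2 - (w p).2) ∪ Sh ((w p).2 - (w j').2) := by
  have hps : ∀ a b : V3, Torus.proj (a - b) = Torus.proj a - Torus.proj b := fun _ _ => rfl
  have hpa : ∀ a b : V3, Torus.proj (a + b) = Torus.proj a + Torus.proj b := fun _ _ => rfl
  have hpos : (((freeFlight (Torus.geometry (Fin 3)) (-t) w) j').1 -
        ((freeFlight (Torus.geometry (Fin 3)) (-t) w) p).1) +
        Torus.proj (t' • (((freeFlight (Torus.geometry (Fin 3)) (-t) w) j').2 -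
          ((freeFlight (Torus.geometry (Fin 3)) (-t) w) p).2)) =
      ((w j').1 - (w p).1) + Torus.proj ((t' - t) • ((w j').2 - (w p).2)) := by
    have h1 : (t' - t) • ((w j').2 - (w p).2) =
        t' • ((w j').2 - (w p).2) + ((-t) • (w j').2 - (-t) • (w p).2) := by
      rw [sub_smul, smul_sub, smul_sub, neg_smul, neg_smul]; abel
    simp only [freeFlight_apply, Torus.geometry_translate]
    rw [h1, hpa, hps]
    abel
  rw [hpos] at hc
  have h2 : Torus.proj (Torus.reprSym ((w j').1 - (w p).1) + (t' - t) • ((w j').2 - (w p).2)) =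
      Torus.proj (Torus.reprSym (((w j').1 - (w p).1) + Torus.proj ((t' - t) • ((w j').2 - (w p).2)))) := by
    rw [Torus.proj_reprSym, hpa, Torus.proj_reprSym]
  obtain ⟨k, hk⟩ := (Torus.proj_eq_proj_iff_holds _ _).1 h2
  have hnorm : ‖(Torus.reprSym ((w j').1 - (w p).1) + Torus.latticeVec k) + (t' - t) • ((w j').2 - (w p).2)‖ = ε := by
    have : Torus.reprSym ((w j').1 - (w p).1) + Torus.latticeVec k + (t' - t) • ((w j').2 - (w p).2) =
        Torus.reprSym ((w j').1 - (w p).1) + (t' - t) • ((w j').2 - (w p).2) + Torus.latticeVec k := by abel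
    rw [this, ← hk, hc]
  have hr : ε ≤ ‖Torus.reprSym ((w j').1 - (w p).1) + Torus.latticeVec k‖ :=
    (hw j' p hj'p).trans (norm_reprSym_le_norm_add_latticeVec _ k)
  refine ⟨k, ?_⟩
  rcases le_or_gt 0 (t' - t) with h0 | h0
  · exact Or.inl (hSℓ _ _ (t' - t) hr ⟨h0, by linarith [ht'.2, ht.1]⟩ hnorm)
  · refine Or.inr (hSh ((w p).2 - (w j').2) _ (t - t') hr ⟨by linarith, by linarith [ht.2, ht'.1]⟩ ?_)
    have : Torus.reprSym ((w j').1 - (w p).1) + Torus.latticeVec k + (t - t') • ((w p).2 - (w j').2) =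
        Torus.reprSym ((w j').1 - (w p).1) + Torus.latticeVec k + (t' - t) • ((w j').2 - (w p).2) := by
      rw [← neg_sub t' t, ← neg_sub (w j').2 (w p).2, smul_neg, neg_smul, neg_neg]
    rw [this]
    exact hnorm

/-! ## Statics: the window event of a pair and the tube event of a third particle -/

/-- **Three-label statics of a window event and a tube event.**  Under the rung-0 law, for distinct labels
`p, m, j'` with the three-label canonical bound `htriple` (`≤ 8 vol T · vol T'`, Ruelle), a swept-tube
family `Sh` of window length `h` and `Sℓ` of length `ℓ` (`vol ≤ 4ε²·length·‖u‖`) and the minimal-image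
lift inequality `hlift`: the probability that a lift of `x_m − x_p` lies in `Sh(v_p − v_m)` AND a lift of
`x_{j'} − x_p` lies in the two-sided tube `Sℓ(v_{j'} − v_p) ∪ Sh(v_p − v_{j'})` is at most
`128 ε⁴ h (ℓ + h) · E‖w − v‖²` (`2ab ≤ a² + b²` on the product of the two relative speeds). [folklore] -/
theorem measure_windowEvent_inter_tubeEvent_le {σ : ℝ} (hσ2 : σ ≤ 1 / 2) {a θ : ℝ} (ha : 0 < a)
    (hθ : 0 < θ) (u : V3) {N : ℕ} (Φ : HardSphereFlow (Torus.geometry (Fin 3)) (hsDiameter σ N) (N + 1))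
    {p m j' : Fin (N + 1)} (hpm : p ≠ m) (hpj : p ≠ j')
    (htriple : ∀ T T' : Set T3, MeasurableSet T → MeasurableSet T' →
      posGibbsMeasure (fun _ : T3 => (1 : ℝ)) (hsDiameter σ N) (N + 1) {x | x m - x p ∈ T ∧ x j' - x p ∈ T'} ≤
        8 * (volume T * volume T'))
    {h ℓ : ℝ} (hh : 0 ≤ h) (hℓ : 0 ≤ ℓ) {Sh Sℓ : V3 → Set V3}
    (hShm : MeasurableSet {q : V3 × V3 | q.1 ∈ Sh q.2}) (hSℓm : MeasurableSet {q : V3 × V3 | q.1 ∈ Sℓ q.2})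
    (hShvol : ∀ v, volume (Sh v) ≤ ENNReal.ofReal (4 * hsDiameter σ N ^ 2 * h * ‖v‖))
    (hSℓvol : ∀ v, volume (Sℓ v) ≤ ENNReal.ofReal (4 * hsDiameter σ N ^ 2 * ℓ * ‖v‖))
    (hlift : ∀ B : Set V3, MeasurableSet B →
      volume {x : T3 | ∃ k : Fin 3 → ℤ, Torus.reprSym x + Torus.latticeVec k ∈ B} ≤ volume B) :
    localGibbsLaw σ (fun _ => a) (fun _ => u) (fun _ => θ) N Φ
        ({w | ∃ k : Fin 3 → ℤ, Torus.reprSym ((w m).1 - (w p).1) + Torus.latticeVec k ∈ Sh ((w p).2 - (w m).2)} ∩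
          {w | ∃ k : Fin 3 → ℤ, Torus.reprSym ((w j').1 - (w p).1) + Torus.latticeVec k ∈
            Sℓ ((w j').2 - (w p).2) ∪ Sh ((w p).2 - (w j').2)}) ≤
      ENNReal.ofReal (128 * hsDiameter σ N ^ 4 * h * (ℓ + h)) *
        ∫⁻ q, ENNReal.ofReal (‖q.2 - q.1‖ ^ 2) ∂((gaussMeasure u θ).prod (gaussMeasure u θ)) := by
  set ε := hsDiameter σ N with hε
  -- measurable sections
  have hShu : ∀ v : V3, MeasurableSet (Sh v) := fun v => hShm.preimage (measurable_id.prodMk measurable_const)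
  have hSℓu : ∀ v : V3, MeasurableSet (Sℓ v) := fun v => hSℓm.preimage (measurable_id.prodMk measurable_const)
  -- the position events for fixed velocities
  set T₁ : (Fin (N + 1) → V3) → Set T3 := fun v =>
    {y | ∃ k : Fin 3 → ℤ, Torus.reprSym y + Torus.latticeVec k ∈ Sh (v p - v m)} with hT₁
  set T₂ : (Fin (N + 1) → V3) → Set T3 := fun v =>
    {y | ∃ k : Fin 3 → ℤ, Torus.reprSym y + Torus.latticeVec k ∈ Sℓ (v j' - v p) ∪ Sh (v p - v j')} with hT₂
  have hpre : ∀ (B : Set V3), MeasurableSet B →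
      MeasurableSet {y : T3 | ∃ k : Fin 3 → ℤ, Torus.reprSym y + Torus.latticeVec k ∈ B} := by
    intro B hB
    have : {y : T3 | ∃ k : Fin 3 → ℤ, Torus.reprSym y + Torus.latticeVec k ∈ B} =
        ⋃ k : Fin 3 → ℤ, (fun y : T3 => Torus.reprSym y + Torus.latticeVec k) ⁻¹' B := by
      ext y; simp only [mem_setOf_eq, mem_iUnion, mem_preimage]
    rw [this]
    exact MeasurableSet.iUnion fun k => hB.preimage (Torus.measurable_reprSym.add_const _)
  have hT₁m : ∀ v, MeasurableSet (T₁ v) := fun v => hpre _ (hShu _)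
  have hT₂m : ∀ v, MeasurableSet (T₂ v) := fun v => hpre _ ((hSℓu _).union (hShu _))
  have hT₁vol : ∀ v, volume (T₁ v) ≤ ENNReal.ofReal (4 * ε ^ 2 * h * ‖v p - v m‖) := fun v =>
    (hlift _ (hShu _)).trans (hShvol _)
  have hT₂vol : ∀ v, volume (T₂ v) ≤
      ENNReal.ofReal (4 * ε ^ 2 * ℓ * ‖v j' - v p‖) + ENNReal.ofReal (4 * ε ^ 2 * h * ‖v p - v j'‖) := by
    intro v
    have hsub : T₂ v ⊆ {y : T3 | ∃ k : Fin 3 → ℤ, Torus.reprSym y + Torus.latticeVec k ∈ Sℓ (v j' - v p)} ∪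
        {y : T3 | ∃ k : Fin 3 → ℤ, Torus.reprSym y + Torus.latticeVec k ∈ Sh (v p - v j')} := by
      rintro y ⟨k, hk | hk⟩
      · exact Or.inl ⟨k, hk⟩
      · exact Or.inr ⟨k, hk⟩
    exact (measure_mono hsub).trans ((measure_union_le _ _).trans (add_le_add
      ((hlift _ (hSℓu _)).trans (hSℓvol _)) ((hlift _ (hShu _)).trans (hShvol _))))
  -- the event and its measurability
  set A : Set (Config (N + 1) (Fin 3) T3) :=
    {w | ∃ k : Fin 3 → ℤ, Torus.reprSym ((w m).1 - (w p).1) + Torus.latticeVec k ∈ Sh ((w p).2 - (w m).2)} ∩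
      {w | ∃ k : Fin 3 → ℤ, Torus.reprSym ((w j').1 - (w p).1) + Torus.latticeVec k ∈
        Sℓ ((w j').2 - (w p).2) ∪ Sh ((w p).2 - (w j').2)} with hA
  have hψm : ∀ (i j i' j'' : Fin (N + 1)) (k : Fin 3 → ℤ), Measurable fun w : Config (N + 1) (Fin 3) T3 =>
      (Torus.reprSym ((w i).1 - (w j).1) + Torus.latticeVec k, (w i').2 - (w j'').2) := by
    intro i j i' j'' k
    refine Measurable.prodMk ?_ ?_
    · exact (Torus.measurable_reprSym.comp
        ((measurable_pi_apply i).fst.sub (measurable_pi_apply j).fst)).add_const _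
    · exact (measurable_pi_apply i').snd.sub (measurable_pi_apply j'').snd
  have hAm : MeasurableSet A := by
    have h1 : {w : Config (N + 1) (Fin 3) T3 | ∃ k : Fin 3 → ℤ,
        Torus.reprSym ((w m).1 - (w p).1) + Torus.latticeVec k ∈ Sh ((w p).2 - (w m).2)} =
        ⋃ k : Fin 3 → ℤ, (fun w : Config (N + 1) (Fin 3) T3 =>
          (Torus.reprSym ((w m).1 - (w p).1) + Torus.latticeVec k, (w p).2 - (w m).2)) ⁻¹'
            {q : V3 × V3 | q.1 ∈ Sh q.2} := by
      ext w; simp only [mem_setOf_eq, mem_iUnion, mem_preimage]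
    have h2 : {w : Config (N + 1) (Fin 3) T3 | ∃ k : Fin 3 → ℤ,
        Torus.reprSym ((w j').1 - (w p).1) + Torus.latticeVec k ∈ Sℓ ((w j').2 - (w p).2) ∪ Sh ((w p).2 - (w j').2)} =
        ⋃ k : Fin 3 → ℤ, ((fun w : Config (N + 1) (Fin 3) T3 =>
          (Torus.reprSym ((w j').1 - (w p).1) + Torus.latticeVec k, (w j').2 - (w p).2)) ⁻¹'
            {q : V3 × V3 | q.1 ∈ Sℓ q.2} ∪
          (fun w : Config (N + 1) (Fin 3) T3 =>
            (Torus.reprSym ((w j').1 - (w p).1) + Torus.latticeVec k, (w p).2 - (w j').2)) ⁻¹'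
            {q : V3 × V3 | q.1 ∈ Sh q.2}) := by
      ext w; simp only [mem_setOf_eq, mem_iUnion, mem_preimage, mem_union]
    rw [hA, h1, h2]
    exact (MeasurableSet.iUnion fun k => hShm.preimage (hψm m p p m k)).inter
      (MeasurableSet.iUnion fun k => (hSℓm.preimage (hψm j' p j' p k)).union (hShm.preimage (hψm j' p p j' k)))
  -- the rung-0 law
  set Q := posGibbsMeasure (fun _ : T3 => a) ε (N + 1) with hQ
  set Γ : Measure (Fin (N + 1) → V3) := Measure.pi fun _ => gaussMeasure u θ with hΓ
  have hlaw : localGibbsLaw σ (fun _ => a) (fun _ => u) (fun _ => θ) N Φ = (Q.prod Γ).map zipConfig := by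
    rw [localGibbsLaw_eq, localGibbsMeasure_rung0_eq_map σ ha.le hθ u N]
  haveI : IsProbabilityMeasure Q := isProbabilityMeasure_posGibbsMeasure continuous_const (fun _ => ha) hσ2 N
  haveI : IsProbabilityMeasure Γ := by rw [hΓ]; infer_instance
  -- the sections
  have hsec : ∀ v : Fin (N + 1) → V3, Q ((fun x => (x, v)) ⁻¹' (zipConfig ⁻¹' A)) ≤
      ENNReal.ofReal (64 * ε ^ 4 * h * (ℓ + h) * (‖v p - v m‖ ^ 2 + ‖v p - v j'‖ ^ 2)) := by
    intro v
    have hset : (fun x => (x, v)) ⁻¹' (zipConfig ⁻¹' A) = {x | x m - x p ∈ T₁ v ∧ x j' - x p ∈ T₂ v} := by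
      ext x
      simp only [hA, hT₁, hT₂, mem_preimage, mem_inter_iff, mem_setOf_eq, zipConfig_apply]
    rw [hset, hQ, posGibbsMeasure_const_eq_one ha]
    refine (htriple _ _ (hT₁m v) (hT₂m v)).trans ?_
    have hb : ‖v j' - v p‖ = ‖v p - v j'‖ := norm_sub_rev _ _
    calc 8 * (volume (T₁ v) * volume (T₂ v))
        ≤ 8 * (ENNReal.ofReal (4 * ε ^ 2 * h * ‖v p - v m‖) *
            (ENNReal.ofReal (4 * ε ^ 2 * ℓ * ‖v j' - v p‖) + ENNReal.ofReal (4 * ε ^ 2 * h * ‖v p - v j'‖))) := by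
          gcongr
          · exact hT₁vol v
          · exact hT₂vol v
      _ = ENNReal.ofReal (8 * ((4 * ε ^ 2 * h * ‖v p - v m‖) *
            (4 * ε ^ 2 * ℓ * ‖v p - v j'‖ + 4 * ε ^ 2 * h * ‖v p - v j'‖))) := by
          rw [hb, ← ENNReal.ofReal_add (by positivity) (by positivity), ← ENNReal.ofReal_mul (by positivity),
            ← ENNReal.ofReal_ofNat 8, ← ENNReal.ofReal_mul (by norm_num)]
      _ ≤ ENNReal.ofReal (64 * ε ^ 4 * h * (ℓ + h) * (‖v p - v m‖ ^ 2 + ‖v p - v j'‖ ^ 2)) := by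
          refine ENNReal.ofReal_le_ofReal ?_
          have hab : 2 * (‖v p - v m‖ * ‖v p - v j'‖) ≤ ‖v p - v m‖ ^ 2 + ‖v p - v j'‖ ^ 2 := by
            nlinarith [sq_nonneg (‖v p - v m‖ - ‖v p - v j'‖)]
          have hc : 0 ≤ 64 * ε ^ 4 * h * (ℓ + h) := by positivity
          nlinarith [mul_le_mul_of_nonneg_left hab hc]
  -- Gaussian second moments of the two relative velocities
  have hmeas2 : ∀ i j : Fin (N + 1), Measurable fun v : Fin (N + 1) → V3 => ENNReal.ofReal (‖v i - v j‖ ^ 2) :=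
    fun i j => by fun_prop
  have hpair2 : ∀ i j : Fin (N + 1), i ≠ j → ∫⁻ v, ENNReal.ofReal (‖v i - v j‖ ^ 2) ∂Γ =
      ∫⁻ q, ENNReal.ofReal (‖q.2 - q.1‖ ^ 2) ∂((gaussMeasure u θ).prod (gaussMeasure u θ)) := by
    intro i j hij
    rw [hΓ, lintegral_pi_pair (gaussMeasure u θ) hij (f := fun q : V3 × V3 => ENNReal.ofReal (‖q.1 - q.2‖ ^ 2))
      (by fun_prop)]
    refine lintegral_congr fun q => ?_
    rw [norm_sub_rev]
  calc localGibbsLaw σ (fun _ => a) (fun _ => u) (fun _ => θ) N Φ A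
      = (Q.prod Γ) (zipConfig ⁻¹' A) := by rw [hlaw, Measure.map_apply measurable_zipConfig hAm]
    _ = ∫⁻ v, Q ((fun x => (x, v)) ⁻¹' (zipConfig ⁻¹' A)) ∂Γ := Measure.prod_apply_symm (measurable_zipConfig hAm)
    _ ≤ ∫⁻ v, ENNReal.ofReal (64 * ε ^ 4 * h * (ℓ + h) * (‖v p - v m‖ ^ 2 + ‖v p - v j'‖ ^ 2)) ∂Γ :=
        lintegral_mono hsec
    _ = ∫⁻ v, ENNReal.ofReal (64 * ε ^ 4 * h * (ℓ + h)) *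
          (ENNReal.ofReal (‖v p - v m‖ ^ 2) + ENNReal.ofReal (‖v p - v j'‖ ^ 2)) ∂Γ := by
        refine lintegral_congr fun v => ?_
        rw [ENNReal.ofReal_mul (by positivity), ENNReal.ofReal_add (by positivity) (by positivity)]
    _ = ENNReal.ofReal (64 * ε ^ 4 * h * (ℓ + h)) *
          (∫⁻ v, ENNReal.ofReal (‖v p - v m‖ ^ 2) ∂Γ + ∫⁻ v, ENNReal.ofReal (‖v p - v j'‖ ^ 2) ∂Γ) := by
        rw [lintegral_const_mul' _ _ ENNReal.ofReal_ne_top, lintegral_add_left (hmeas2 p m)]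
    _ = ENNReal.ofReal (128 * ε ^ 4 * h * (ℓ + h)) *
          ∫⁻ q, ENNReal.ofReal (‖q.2 - q.1‖ ^ 2) ∂((gaussMeasure u θ).prod (gaussMeasure u θ)) := by
        rw [hpair2 p m hpm, hpair2 p j' hpj, ← two_mul, ← mul_assoc]
        congr 1
        rw [show (2 : ℝ≥0∞) = ENNReal.ofReal 2 by norm_num, ← ENNReal.ofReal_mul (by positivity)]
        congr 1
        ring

/-! ## The collision sum of the forward-contact count -/

/-- **Window bound for the collision sum of the forward-contact count (rung 0).**  For `σ ≤ 1/2`,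
constant profiles `a, θ > 0`, `u`, a flow `Φ` preserving the homogeneous Gibbs law (`hstat`), the
three-label canonical bound `htriple`, swept tubes `htube` and the lift inequality `hlift`: for `τ, ℓ, η > 0`
the probability that a good orbit has
`Σ_{collisions (s,p,m), s ∈ [0,τ]} #{j' ∉ {p,m} : ‖reprSym((x_{j'} − x_p) + proj(t (v_{j'} − v_p)))‖ = ε, t ∈ (0,ℓ)} ≥ η`
(positions and velocities read at the collision) is at most
`η⁻¹ · 256 τ ℓ (N+1)³ ε⁴ · ∫ ‖q.2 − q.1‖² d(N(u,θ) ⊗ N(u,θ))`. [folklore] -/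
theorem localGibbsLaw_fwdHitCollisionSum_ge_le {σ : ℝ} (hσ2 : σ ≤ 1 / 2) {a θ : ℝ} (ha : 0 < a)
    (hθ : 0 < θ) (u : V3) {N : ℕ} (Φ : HardSphereFlow (Torus.geometry (Fin 3)) (hsDiameter σ N) (N + 1))
    (hstat : ∀ t : ℝ, MeasurePreserving (Φ.flow t) (localGibbsLaw σ (fun _ => a) (fun _ => u) (fun _ => θ) N Φ)
      (localGibbsLaw σ (fun _ => a) (fun _ => u) (fun _ => θ) N Φ))
    (htriple : ∀ i j k : Fin (N + 1), i ≠ j → i ≠ k → j ≠ k → ∀ T T' : Set T3, MeasurableSet T → MeasurableSet T' →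
      posGibbsMeasure (fun _ : T3 => (1 : ℝ)) (hsDiameter σ N) (N + 1) {x | x j - x i ∈ T ∧ x k - x i ∈ T'} ≤
        8 * (volume T * volume T'))
    (htube : ∀ h : ℝ, 0 ≤ h → ∃ S : V3 → Set V3, MeasurableSet {q : V3 × V3 | q.1 ∈ S q.2} ∧
      (∀ u, volume (S u) ≤ ENNReal.ofReal (4 * hsDiameter σ N ^ 2 * h * ‖u‖)) ∧
      ∀ (u r : V3) (s : ℝ), hsDiameter σ N ≤ ‖r‖ → s ∈ Icc 0 h → ‖r + s • u‖ = hsDiameter σ N → r ∈ S u)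
    (hlift : ∀ B : Set V3, MeasurableSet B →
      volume {x : T3 | ∃ k : Fin 3 → ℤ, Torus.reprSym x + Torus.latticeVec k ∈ B} ≤ volume B)
    {τ : ℝ} (hτ : 0 < τ) {ℓ : ℝ} (hℓ : 0 < ℓ) {η : ℝ} (hη : 0 < η) :
    localGibbsLaw σ (fun _ => a) (fun _ => u) (fun _ => θ) N Φ
        {z | z ∈ Φ.good ∧ η ≤ ∑ᶠ s ∈ collisionTimes (Torus.geometry (Fin 3)) (hsDiameter σ N)
            (fun t => Φ.flow t z) ∩ Icc 0 τ,
          ∑ i : Fin (N + 1), ∑ j : Fin (N + 1),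
            (if i ≠ j ∧ ‖(Torus.geometry (Fin 3)).sepVec (Φ.flow s z i).1 (Φ.flow s z j).1‖ = hsDiameter σ N
              then (∑ j' : Fin (N + 1), if j' ≠ i ∧ j' ≠ j ∧ ∃ t ∈ Ioo 0 ℓ,
                ‖Torus.reprSym (((Φ.flow s z j').1 - (Φ.flow s z i).1) +
                  Torus.proj (t • ((Φ.flow s z j').2 - (Φ.flow s z i).2)))‖ = hsDiameter σ N
                then (1 : ℝ) else 0) else 0)} ≤
      (ENNReal.ofReal η)⁻¹ * (ENNReal.ofReal (256 * τ * ℓ * ((N + 1 : ℕ) : ℝ) ^ 3 * hsDiameter σ N ^ 4) *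
        ∫⁻ q, ENNReal.ofReal (‖q.2 - q.1‖ ^ 2) ∂((gaussMeasure u θ).prod (gaussMeasure u θ))) := by
  classical
  set P := localGibbsLaw σ (fun _ => a) (fun _ => u) (fun _ => θ) N Φ with hPdef
  set m₂ := ∫⁻ q, ENNReal.ofReal (‖q.2 - q.1‖ ^ 2) ∂((gaussMeasure u θ).prod (gaussMeasure u θ)) with hm₂
  -- tube families: length `ℓ`, and length `τ / M` for every mesh
  obtain ⟨Sℓ, hSℓm, hSℓvol, hSℓ⟩ := htube ℓ hℓ.le
  have hhM : ∀ M : ℕ, 0 ≤ τ / M := fun M => div_nonneg hτ.le (Nat.cast_nonneg M)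
  choose Sh hShm hShvol hSh using fun M : ℕ => htube (τ / M) (hhM M)
  -- events, mark, majorants
  set E : ℕ → Fin (N + 1) → Fin (N + 1) → Set (Config (N + 1) (Fin 3) T3) := fun M p m =>
    {w | ∃ k : Fin 3 → ℤ, Torus.reprSym ((w m).1 - (w p).1) + Torus.latticeVec k ∈ Sh M ((w p).2 - (w m).2)}
    with hEdef
  set E' : ℕ → Fin (N + 1) → Fin (N + 1) → Set (Config (N + 1) (Fin 3) T3) := fun M p j' =>
    {w | ∃ k : Fin 3 → ℤ, Torus.reprSym ((w j').1 - (w p).1) + Torus.latticeVec k ∈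
      Sℓ ((w j').2 - (w p).2) ∪ Sh M ((w p).2 - (w j').2)} with hE'def
  set F : Config (N + 1) (Fin 3) T3 → Fin (N + 1) → Fin (N + 1) → ℝ≥0∞ := fun w p m =>
    ∑ j' : Fin (N + 1), if j' ≠ p ∧ j' ≠ m ∧ ∃ t ∈ Ioo 0 ℓ,
      ‖Torus.reprSym (((w j').1 - (w p).1) + Torus.proj (t • ((w j').2 - (w p).2)))‖ = (hsDiameter σ N)
      then (1 : ℝ≥0∞) else 0 with hFdef
  set Ft : ℕ → Config (N + 1) (Fin 3) T3 → Fin (N + 1) → Fin (N + 1) → ℝ≥0∞ := fun M w p m =>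
    ∑ j' : Fin (N + 1), if j' ≠ p ∧ j' ≠ m then (E M p m ∩ E' M p j').indicator 1 w else 0 with hFtdef
  -- measurability
  have hψm : ∀ (i j i' j'' : Fin (N + 1)) (k : Fin 3 → ℤ), Measurable fun w : Config (N + 1) (Fin 3) T3 =>
      (Torus.reprSym ((w i).1 - (w j).1) + Torus.latticeVec k, (w i').2 - (w j'').2) := by
    intro i j i' j'' k
    refine Measurable.prodMk ?_ ?_
    · exact (Torus.measurable_reprSym.comp
        ((measurable_pi_apply i).fst.sub (measurable_pi_apply j).fst)).add_const _
    · exact (measurable_pi_apply i').snd.sub (measurable_pi_apply j'').snd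
  have hEm : ∀ M p m, MeasurableSet (E M p m) := by
    intro M p m
    have h1 : E M p m = ⋃ k : Fin 3 → ℤ, (fun w : Config (N + 1) (Fin 3) T3 =>
        (Torus.reprSym ((w m).1 - (w p).1) + Torus.latticeVec k, (w p).2 - (w m).2)) ⁻¹'
          {q : V3 × V3 | q.1 ∈ Sh M q.2} := by
      ext w; simp only [hEdef, mem_setOf_eq, mem_iUnion, mem_preimage]
    rw [h1]
    exact MeasurableSet.iUnion fun k => (hShm M).preimage (hψm m p p m k)
  have hE'm : ∀ M p j', MeasurableSet (E' M p j') := by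
    intro M p j'
    have h2 : E' M p j' = ⋃ k : Fin 3 → ℤ, ((fun w : Config (N + 1) (Fin 3) T3 =>
          (Torus.reprSym ((w j').1 - (w p).1) + Torus.latticeVec k, (w j').2 - (w p).2)) ⁻¹'
            {q : V3 × V3 | q.1 ∈ Sℓ q.2} ∪
          (fun w : Config (N + 1) (Fin 3) T3 =>
            (Torus.reprSym ((w j').1 - (w p).1) + Torus.latticeVec k, (w p).2 - (w j').2)) ⁻¹'
            {q : V3 × V3 | q.1 ∈ Sh M q.2}) := by
      ext w; simp only [hE'def, mem_setOf_eq, mem_iUnion, mem_preimage, mem_union]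
    rw [h2]
    exact MeasurableSet.iUnion fun k => (hSℓm.preimage (hψm j' p j' p k)).union ((hShm M).preimage (hψm j' p p j' k))
  have hsm : ∀ M p m j', Measurable fun w : Config (N + 1) (Fin 3) T3 =>
      (if j' ≠ p ∧ j' ≠ m then (E M p m ∩ E' M p j').indicator 1 w else 0 : ℝ≥0∞) := by
    intro M p m j'
    by_cases hj : j' ≠ p ∧ j' ≠ m
    · simp only [if_pos hj]
      exact measurable_one.indicator ((hEm M p m).inter (hE'm M p j'))
    · simp only [if_neg hj]
      exact measurable_const
  have hFtm : ∀ M p m, Measurable fun w => Ft M w p m := fun M p m =>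
    Finset.measurable_sum _ fun j' _ => hsm M p m j'
  -- covering property of the window events
  have hEc : ∀ (M : ℕ) (p m : Fin (N + 1)), p ≠ m →
      ∀ w ∈ hardSphereDomain (Torus.geometry (Fin 3)) (N + 1) (hsDiameter σ N), ∀ t ∈ Icc 0 (τ / M),
      ‖(Torus.geometry (Fin 3)).sepVec ((freeFlight (Torus.geometry (Fin 3)) (-t) w p).1)
        ((freeFlight (Torus.geometry (Fin 3)) (-t) w m).1)‖ = (hsDiameter σ N) → w ∈ E M p m := by
    intro M p m hpm w hw t ht hc
    have hc' : ‖(Torus.geometry (Fin 3)).sepVec ((freeFlight (Torus.geometry (Fin 3)) (-t) w m).1)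
        ((freeFlight (Torus.geometry (Fin 3)) (-t) w p).1)‖ = (hsDiameter σ N) := by
      rw [Torus.norm_geometry_sepVec, Torus.euclidDist_comm, ← Torus.norm_geometry_sepVec]
      exact hc
    exact exists_latticeVec_add_mem_of_contact (hSh M) hw hpm.symm ht hc'
  -- the majorants dominate the mark along the window
  have hFt : ∀ (M : ℕ) (p m : Fin (N + 1)), p ≠ m →
      ∀ w ∈ hardSphereDomain (Torus.geometry (Fin 3)) (N + 1) (hsDiameter σ N), ∀ t ∈ Icc 0 (τ / M),
      ‖(Torus.geometry (Fin 3)).sepVec ((freeFlight (Torus.geometry (Fin 3)) (-t) w p).1)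
        ((freeFlight (Torus.geometry (Fin 3)) (-t) w m).1)‖ = (hsDiameter σ N) →
        F (freeFlight (Torus.geometry (Fin 3)) (-t) w) p m ≤ Ft M w p m := by
    intro M p m hpm w hw t ht hc
    refine Finset.sum_le_sum fun j' _ => ?_
    by_cases hcond : j' ≠ p ∧ j' ≠ m ∧ ∃ t' ∈ Ioo 0 ℓ,
        ‖Torus.reprSym ((((freeFlight (Torus.geometry (Fin 3)) (-t) w) j').1 -
          ((freeFlight (Torus.geometry (Fin 3)) (-t) w) p).1) +
          Torus.proj (t' • (((freeFlight (Torus.geometry (Fin 3)) (-t) w) j').2 -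
            ((freeFlight (Torus.geometry (Fin 3)) (-t) w) p).2)))‖ = (hsDiameter σ N)
    · obtain ⟨hj'p, hj'm, t', ht', hhit⟩ := hcond
      rw [if_pos ⟨hj'p, hj'm, t', ht', hhit⟩, if_pos ⟨hj'p, hj'm⟩]
      have hmem : w ∈ E M p m ∩ E' M p j' :=
        ⟨hEc M p m hpm w hw t ht hc, exists_latticeVec_mem_twoSidedTube (hSh M) hSℓ hw hj'p ht ht' hhit⟩
      rw [indicator_of_mem hmem, Pi.one_apply]
    · rw [if_neg hcond]
      exact bot_le
  -- the abstract window bound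
  have hη0 : ENNReal.ofReal η ≠ 0 := (ENNReal.ofReal_pos.2 hη).ne'
  have hgen := measure_collisionSum_ge_le_liminf Φ P hstat hτ F E hEm hEc Ft hFtm hFt hη0 ENNReal.ofReal_ne_top
  -- the real collision sum is the `ℝ≥0∞` one on the good set
  have hsub : {z | z ∈ Φ.good ∧ η ≤ ∑ᶠ s ∈ collisionTimes (Torus.geometry (Fin 3)) (hsDiameter σ N) (fun t => Φ.flow t z) ∩ Icc 0 τ,
      ∑ i : Fin (N + 1), ∑ j : Fin (N + 1),
        (if i ≠ j ∧ ‖(Torus.geometry (Fin 3)).sepVec (Φ.flow s z i).1 (Φ.flow s z j).1‖ = (hsDiameter σ N)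
          then (∑ j' : Fin (N + 1), if j' ≠ i ∧ j' ≠ j ∧ ∃ t ∈ Ioo 0 ℓ,
            ‖Torus.reprSym (((Φ.flow s z j').1 - (Φ.flow s z i).1) +
              Torus.proj (t • ((Φ.flow s z j').2 - (Φ.flow s z i).2)))‖ = (hsDiameter σ N)
            then (1 : ℝ) else 0) else 0)} ⊆
      {z | z ∈ Φ.good ∧ ENNReal.ofReal η ≤ ∑ᶠ s ∈ collisionTimes (Torus.geometry (Fin 3)) (hsDiameter σ N)
          (fun t => Φ.flow t z) ∩ Icc 0 τ,
        ∑ i : Fin (N + 1), ∑ j : Fin (N + 1),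
          (if i ≠ j ∧ ‖(Torus.geometry (Fin 3)).sepVec (Φ.flow s z i).1 (Φ.flow s z j).1‖ = (hsDiameter σ N)
            then F (Φ.flow s z) i j else 0)} := by
    rintro z ⟨hz, hle⟩
    refine ⟨hz, ?_⟩
    have hfin := (Φ.isTrajectory z hz).locFinite 0 τ
    rw [finsum_mem_eq_finite_toFinset_sum _ hfin] at hle ⊢
    have hnn : ∀ (s : ℝ) (i j : Fin (N + 1)), (0 : ℝ) ≤
        (if i ≠ j ∧ ‖(Torus.geometry (Fin 3)).sepVec (Φ.flow s z i).1 (Φ.flow s z j).1‖ = (hsDiameter σ N)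
          then (∑ j' : Fin (N + 1), if j' ≠ i ∧ j' ≠ j ∧ ∃ t ∈ Ioo 0 ℓ,
            ‖Torus.reprSym (((Φ.flow s z j').1 - (Φ.flow s z i).1) +
              Torus.proj (t • ((Φ.flow s z j').2 - (Φ.flow s z i).2)))‖ = (hsDiameter σ N)
            then (1 : ℝ) else 0) else 0) := by
      intro s i j
      split_ifs
      · exact Finset.sum_nonneg fun j' _ => by split_ifs <;> norm_num
      · exact le_rfl
    refine (ENNReal.ofReal_le_ofReal hle).trans (le_of_eq ?_)
    rw [ENNReal.ofReal_sum_of_nonneg fun s _ => Finset.sum_nonneg fun i _ =>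
      Finset.sum_nonneg fun j _ => hnn s i j]
    refine Finset.sum_congr rfl fun s _ => ?_
    rw [ENNReal.ofReal_sum_of_nonneg fun i _ => Finset.sum_nonneg fun j _ => hnn s i j]
    refine Finset.sum_congr rfl fun i _ => ?_
    rw [ENNReal.ofReal_sum_of_nonneg fun j _ => hnn s i j]
    refine Finset.sum_congr rfl fun j _ => ?_
    by_cases hc : i ≠ j ∧ ‖(Torus.geometry (Fin 3)).sepVec (Φ.flow s z i).1 (Φ.flow s z j).1‖ = (hsDiameter σ N)
    · rw [if_pos hc, if_pos hc, hFdef]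
      dsimp only
      rw [ENNReal.ofReal_sum_of_nonneg fun j' _ => by split_ifs <;> norm_num]
      refine Finset.sum_congr rfl fun j' _ => ?_
      split_ifs <;> simp
    · rw [if_neg hc, if_neg hc, ENNReal.ofReal_zero]
  -- the mean of one window
  have hB : ∀ M : ℕ, 0 < M → τ / M ≤ ℓ → (M : ℝ≥0∞) * ∫⁻ w, ∑ p, ∑ m,
      (if p ≠ m then (E M p m).indicator (fun w => Ft M w p m) w else 0) ∂P ≤
        ENNReal.ofReal (256 * τ * ℓ * ((N + 1 : ℕ) : ℝ) ^ 3 * (hsDiameter σ N) ^ 4) * m₂ := by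
    intro M hM hMℓ
    have hM' : (0 : ℝ) < M := by exact_mod_cast hM
    set c : ℝ≥0∞ := ENNReal.ofReal (128 * (hsDiameter σ N) ^ 4 * (τ / M) * (ℓ + τ / M)) * m₂ with hc
    -- one ordered pair
    have hterm : ∀ p m : Fin (N + 1), p ≠ m →
        ∫⁻ w, (E M p m).indicator (fun w => Ft M w p m) w ∂P ≤ ((N + 1 : ℕ) : ℝ≥0∞) * c := by
      intro p m hpm
      have hind : ∀ w, (E M p m).indicator (fun w => Ft M w p m) w =
          ∑ j' : Fin (N + 1), (if j' ≠ p ∧ j' ≠ m then (E M p m ∩ E' M p j').indicator 1 w else 0 : ℝ≥0∞) := by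
        intro w
        by_cases hw : w ∈ E M p m
        · rw [indicator_of_mem hw]
        · rw [indicator_of_notMem hw]
          symm
          refine Finset.sum_eq_zero fun j' _ => ?_
          split_ifs
          · exact indicator_of_notMem (fun h => hw h.1) _
          · rfl
      calc ∫⁻ w, (E M p m).indicator (fun w => Ft M w p m) w ∂P
          = ∑ j' : Fin (N + 1), ∫⁻ w, (if j' ≠ p ∧ j' ≠ m then (E M p m ∩ E' M p j').indicator 1 w else 0 : ℝ≥0∞) ∂P := by
            rw [← lintegral_finsetSum _ fun j' _ => hsm M p m j']
            exact lintegral_congr hind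
        _ ≤ ∑ _j' : Fin (N + 1), c := by
            refine Finset.sum_le_sum fun j' _ => ?_
            by_cases hj : j' ≠ p ∧ j' ≠ m
            · simp only [if_pos hj]
              rw [lintegral_indicator_one ((hEm M p m).inter (hE'm M p j'))]
              exact measure_windowEvent_inter_tubeEvent_le hσ2 ha hθ u Φ hpm (Ne.symm hj.1)
                (htriple p m j' hpm (Ne.symm hj.1) (Ne.symm hj.2)) (hhM M) hℓ.le (hShm M) hSℓm (hShvol M) hSℓvol hlift
            · simp only [if_neg hj, lintegral_const, zero_mul]
              exact bot_le
        _ = ((N + 1 : ℕ) : ℝ≥0∞) * c := by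
            rw [Finset.sum_const, Finset.card_univ, Fintype.card_fin, nsmul_eq_mul]
    have hmeas : ∀ p m : Fin (N + 1), Measurable fun w : Config (N + 1) (Fin 3) T3 =>
        (if p ≠ m then (E M p m).indicator (fun w => Ft M w p m) w else 0) := by
      intro p m
      by_cases hpm : p ≠ m
      · simp only [if_pos hpm]; exact (hFtm M p m).indicator (hEm M p m)
      · simp only [if_neg hpm]; exact measurable_const
    calc (M : ℝ≥0∞) * ∫⁻ w, ∑ p, ∑ m, (if p ≠ m then (E M p m).indicator (fun w => Ft M w p m) w else 0) ∂P
        = (M : ℝ≥0∞) * ∑ p, ∑ m, ∫⁻ w, (if p ≠ m then (E M p m).indicator (fun w => Ft M w p m) w else 0) ∂P := by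
          congr 1
          rw [lintegral_finsetSum _ fun p _ => Finset.measurable_sum _ fun m _ => hmeas p m]
          exact Finset.sum_congr rfl fun p _ => lintegral_finsetSum _ fun m _ => hmeas p m
      _ ≤ (M : ℝ≥0∞) * ∑ _p : Fin (N + 1), ∑ _m : Fin (N + 1), ((N + 1 : ℕ) : ℝ≥0∞) * c := by
          gcongr with p _ m _
          by_cases hpm : p ≠ m
          · simp only [if_pos hpm]; exact hterm p m hpm
          · simp only [if_neg hpm, lintegral_const, zero_mul]; exact bot_le
      _ = ENNReal.ofReal ((M : ℝ) * ((N + 1 : ℕ) : ℝ) ^ 3 * (128 * (hsDiameter σ N) ^ 4 * (τ / M) * (ℓ + τ / M))) * m₂ := by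
          simp only [Finset.sum_const, Finset.card_univ, Fintype.card_fin, nsmul_eq_mul]
          rw [hc, ← ENNReal.ofReal_natCast M, ← ENNReal.ofReal_natCast (N + 1), ← mul_assoc, ← mul_assoc, ← mul_assoc,
            ← mul_assoc, ← ENNReal.ofReal_mul (Nat.cast_nonneg _), ← ENNReal.ofReal_mul (by positivity),
            ← ENNReal.ofReal_mul (by positivity), ← ENNReal.ofReal_mul (by positivity)]
          congr 2
          ring
      _ ≤ ENNReal.ofReal (256 * τ * ℓ * ((N + 1 : ℕ) : ℝ) ^ 3 * (hsDiameter σ N) ^ 4) * m₂ := by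
          refine mul_le_mul_of_nonneg_right (ENNReal.ofReal_le_ofReal ?_) bot_le
          have hMτ : (M : ℝ) * (τ / M) = τ := by field_simp
          calc (M : ℝ) * ((N + 1 : ℕ) : ℝ) ^ 3 * (128 * (hsDiameter σ N) ^ 4 * (τ / M) * (ℓ + τ / M))
              = 128 * ((M : ℝ) * (τ / M)) * ((N + 1 : ℕ) : ℝ) ^ 3 * (hsDiameter σ N) ^ 4 * (ℓ + τ / M) := by ring
            _ ≤ 128 * τ * ((N + 1 : ℕ) : ℝ) ^ 3 * (hsDiameter σ N) ^ 4 * (ℓ + ℓ) := by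
                rw [hMτ]; gcongr
            _ = 256 * τ * ℓ * ((N + 1 : ℕ) : ℝ) ^ 3 * (hsDiameter σ N) ^ 4 := by ring
  -- eventually in the mesh, hence frequently
  have hfreq : ∃ᶠ M : ℕ in atTop, (M : ℝ≥0∞) * ∫⁻ w, ∑ p, ∑ m,
      (if p ≠ m then (E M p m).indicator (fun w => Ft M w p m) w else 0) ∂P ≤
        ENNReal.ofReal (256 * τ * ℓ * ((N + 1 : ℕ) : ℝ) ^ 3 * (hsDiameter σ N) ^ 4) * m₂ := by
    refine Eventually.frequently ?_
    filter_upwards [eventually_ge_atTop (max 1 ⌈τ / ℓ⌉₊)] with M hM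
    have hM1 : 1 ≤ M := (le_max_left _ _).trans hM
    have hM2 : τ / ℓ ≤ M := (Nat.le_ceil _).trans (by exact_mod_cast (le_max_right _ _).trans hM)
    refine hB M hM1 ?_
    rw [div_le_iff₀ (by exact_mod_cast hM1 : (0 : ℝ) < M)]
    rw [div_le_iff₀ hℓ] at hM2
    linarith
  calc P _ ≤ P _ := measure_mono hsub
    _ ≤ _ := hgen
    _ ≤ (ENNReal.ofReal η)⁻¹ * (ENNReal.ofReal (256 * τ * ℓ * ((N + 1 : ℕ) : ℝ) ^ 3 * (hsDiameter σ N) ^ 4) * m₂) := by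
        gcongr
        exact liminf_le_of_frequently_le' hfreq

/-! ## The short-flight count and the short-flight deficit -/

/-- **The short-flight deficit is at most `C κ ε` times the short-flight count** (pathwise, good orbit,
`|Ψ| ≤ C`, `κ ε > 0`): the deficit of one collision is at most `κ ε` and vanishes unless the pair flight
start exceeds `s − κ ε`. [folklore] -/
theorem shortFlightDeficit_le_mul_count {σ : ℝ} {N : ℕ}
    {Φ : HardSphereFlow (Torus.geometry (Fin 3)) (hsDiameter σ N) (N + 1)} {z : Config (N + 1) (Fin 3) T3}
    (hz : z ∈ Φ.good) {Ψ : V3 × V3 × V3 → ℝ} {C : ℝ} (hΨ : ∀ q, |Ψ q| ≤ C) (τ : ℝ) {κ : ℝ}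
    (hℓ : 0 < κ * hsDiameter σ N) :
    shortFlightDeficit σ N Φ τ Ψ κ z ≤ C * (κ * hsDiameter σ N) *
      collisionPairSum (Torus.geometry (Fin 3)) (hsDiameter σ N) (orbit σ N Φ z) (Icc 0 τ)
        (fun s i j => if s - κ * hsDiameter σ N < pairFlightStart σ N Φ z i j s then (1 : ℝ) else 0) := by
  have hC : 0 ≤ C := (abs_nonneg _).trans (hΨ 0)
  have hfin := (isTraj hz).locFinite 0 τ
  unfold shortFlightDeficit
  rw [← collisionPairSum_const_mul hfin]
  refine collisionPairSum_mono hfin fun s hs p _ => ?_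
  have hD := deficit_le hz p.1 p.2 (ℓ := κ * hsDiameter σ N) hs.2.1 hℓ.le
  by_cases hsh : s - κ * hsDiameter σ N < pairFlightStart σ N Φ z p.1 p.2 s
  · rw [if_pos hsh, mul_one]
    exact mul_le_mul (hΨ _) hD (le_max_right _ _) hC
  · rw [if_neg hsh, mul_zero, max_eq_right (by linarith [not_lt.1 hsh]), mul_zero]

/-- **The short-flight count under the rung-0 Gibbs law (window bound).**  For `0 ≤ σ ≤ 1/4`, constant
profiles `a, θ > 0`, `u`, a flow `Φ` of `N + 1` spheres of diameter `ε = hsDiameter σ N` preserving the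
homogeneous Gibbs law (`hstat`), the canonical pair and three-label bounds `hpair`, `htriple` (Ruelle, small
density), swept tubes `htube` and the lift inequality `hlift`: for `τ, ℓ, y > 0` the probability that a
good orbit has at least `y` ordered collisions `(s, i, j)`, `s ∈ [0, τ]`, with pair flight start `> s − ℓ`
(a partner collided during `(s − ℓ, s)`, or `s < ℓ`) is at most
`y⁻¹ ℓ (48 (N+1)² ε² m₁ + (192 τ (N+1)² ε² + 1536 τ (N+1)³ ε⁴) m₂)`,
`m₁ = ∫ ‖q.2 − q.1‖`, `m₂ = ∫ ‖q.2 − q.1‖²` against `N(u,θ) ⊗ N(u,θ)` — LINEAR in `ℓ`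
(pathwise charging `shortFlightCount_le_chargedSums` + the collision-flux bound for the early and the
fast re-collisions + `localGibbsLaw_fwdHitCollisionSum_ge_le`). [folklore] -/
theorem localGibbsLaw_shortFlightCount_ge_le {σ : ℝ} (hσ : 0 ≤ σ) (hσ4 : σ ≤ 1 / 4) {a θ : ℝ} (ha : 0 < a)
    (hθ : 0 < θ) (u : V3) {N : ℕ} (Φ : HardSphereFlow (Torus.geometry (Fin 3)) (hsDiameter σ N) (N + 1))
    (hstat : ∀ t : ℝ, MeasurePreserving (Φ.flow t) (localGibbsLaw σ (fun _ => a) (fun _ => u) (fun _ => θ) N Φ)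
      (localGibbsLaw σ (fun _ => a) (fun _ => u) (fun _ => θ) N Φ))
    (hpair : ∀ i j : Fin (N + 1), i ≠ j → ∀ T : Set T3, MeasurableSet T →
      posGibbsMeasure (fun _ : T3 => (1 : ℝ)) (hsDiameter σ N) (N + 1) {x | x i - x j ∈ T} ≤ 4 * volume T)
    (htriple : ∀ i j k : Fin (N + 1), i ≠ j → i ≠ k → j ≠ k → ∀ T T' : Set T3, MeasurableSet T → MeasurableSet T' →
      posGibbsMeasure (fun _ : T3 => (1 : ℝ)) (hsDiameter σ N) (N + 1) {x | x j - x i ∈ T ∧ x k - x i ∈ T'} ≤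
        8 * (volume T * volume T'))
    (htube : ∀ h : ℝ, 0 ≤ h → ∃ S : V3 → Set V3, MeasurableSet {q : V3 × V3 | q.1 ∈ S q.2} ∧
      (∀ u, volume (S u) ≤ ENNReal.ofReal (4 * hsDiameter σ N ^ 2 * h * ‖u‖)) ∧
      ∀ (u r : V3) (s : ℝ), hsDiameter σ N ≤ ‖r‖ → s ∈ Icc 0 h → ‖r + s • u‖ = hsDiameter σ N → r ∈ S u)
    (hlift : ∀ B : Set V3, MeasurableSet B →
      volume {x : T3 | ∃ k : Fin 3 → ℤ, Torus.reprSym x + Torus.latticeVec k ∈ B} ≤ volume B)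
    {τ : ℝ} (hτ : 0 < τ) {ℓ : ℝ} (hℓ : 0 < ℓ) {y : ℝ} (hy : 0 < y) :
    localGibbsLaw σ (fun _ => a) (fun _ => u) (fun _ => θ) N Φ
        {z | z ∈ Φ.good ∧ y ≤ collisionPairSum (Torus.geometry (Fin 3)) (hsDiameter σ N) (orbit σ N Φ z) (Icc 0 τ)
          (fun s i j => if s - ℓ < pairFlightStart σ N Φ z i j s then (1 : ℝ) else 0)} ≤
      ENNReal.ofReal (48 * ℓ * ((N + 1 : ℕ) : ℝ) ^ 2 * hsDiameter σ N ^ 2 / y) *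
          ∫⁻ q, ENNReal.ofReal ‖q.2 - q.1‖ ∂((gaussMeasure u θ).prod (gaussMeasure u θ)) +
        ENNReal.ofReal ((192 * τ * ℓ * ((N + 1 : ℕ) : ℝ) ^ 2 * hsDiameter σ N ^ 2 +
            1536 * τ * ℓ * ((N + 1 : ℕ) : ℝ) ^ 3 * hsDiameter σ N ^ 4) / y) *
          ∫⁻ q, ENNReal.ofReal (‖q.2 - q.1‖ ^ 2) ∂((gaussMeasure u θ).prod (gaussMeasure u θ)) := by
  classical
  set P := localGibbsLaw σ (fun _ => a) (fun _ => u) (fun _ => θ) N Φ with hPdef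
  set m₁ := ∫⁻ q, ENNReal.ofReal ‖q.2 - q.1‖ ∂((gaussMeasure u θ).prod (gaussMeasure u θ)) with hm₁
  set m₂ := ∫⁻ q, ENNReal.ofReal (‖q.2 - q.1‖ ^ 2) ∂((gaussMeasure u θ).prod (gaussMeasure u θ)) with hm₂
  have hε4 : hsDiameter σ N ≤ 1 / 4 := (hsDiameter_le hσ N).trans hσ4
  have hε2 : hsDiameter σ N < 1 / 2 := by linarith
  have hσ2 : σ ≤ 1 / 2 := by linarith
  have hR : 0 < (1 / 2 - hsDiameter σ N) / ℓ := div_pos (by linarith) hℓ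
  -- the three charged events
  set B₁ : Set (Config (N + 1) (Fin 3) T3) := {z | z ∈ Φ.good ∧ y / 3 ≤
      ∑ᶠ s ∈ collisionTimes (Torus.geometry (Fin 3)) (hsDiameter σ N) (fun t => Φ.flow t z) ∩ Icc 0 ℓ,
        ∑ i : Fin (N + 1), ∑ j : Fin (N + 1),
          (if i ≠ j ∧ ‖(Torus.geometry (Fin 3)).sepVec (Φ.flow s z i).1 (Φ.flow s z j).1‖ = hsDiameter σ N
            then (fun _ : V3 × V3 => (1 : ℝ)) ((Φ.flow s z i).2, (Φ.flow s z j).2) else 0)} with hB₁def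
  set B₂ : Set (Config (N + 1) (Fin 3) T3) := {z | z ∈ Φ.good ∧ y / 3 ≤
      ∑ᶠ s ∈ collisionTimes (Torus.geometry (Fin 3)) (hsDiameter σ N) (fun t => Φ.flow t z) ∩ Icc 0 τ,
        ∑ i : Fin (N + 1), ∑ j : Fin (N + 1),
          (if i ≠ j ∧ ‖(Torus.geometry (Fin 3)).sepVec (Φ.flow s z i).1 (Φ.flow s z j).1‖ = hsDiameter σ N
            then (fun q : V3 × V3 => ‖q.2 - q.1‖ / ((1 / 2 - hsDiameter σ N) / ℓ)) ((Φ.flow s z i).2, (Φ.flow s z j).2) else 0)} with hB₂def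
  set B₃ : Set (Config (N + 1) (Fin 3) T3) := {z | z ∈ Φ.good ∧ y / 6 ≤
      ∑ᶠ s ∈ collisionTimes (Torus.geometry (Fin 3)) (hsDiameter σ N) (fun t => Φ.flow t z) ∩ Icc 0 τ,
        ∑ i : Fin (N + 1), ∑ j : Fin (N + 1),
          (if i ≠ j ∧ ‖(Torus.geometry (Fin 3)).sepVec (Φ.flow s z i).1 (Φ.flow s z j).1‖ = hsDiameter σ N
            then (∑ j' : Fin (N + 1), if j' ≠ i ∧ j' ≠ j ∧ ∃ t ∈ Ioo 0 ℓ,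
              ‖Torus.reprSym (((Φ.flow s z j').1 - (Φ.flow s z i).1) +
                Torus.proj (t • ((Φ.flow s z j').2 - (Φ.flow s z i).2)))‖ = hsDiameter σ N
              then (1 : ℝ) else 0) else 0)} with hB₃def
  -- pathwise: a large short-flight count makes one of the charged sums large
  have hsub : {z | z ∈ Φ.good ∧ y ≤ collisionPairSum (Torus.geometry (Fin 3)) (hsDiameter σ N) (orbit σ N Φ z)
      (Icc 0 τ) (fun s i j => if s - ℓ < pairFlightStart σ N Φ z i j s then (1 : ℝ) else 0)} ⊆ B₁ ∪ B₂ ∪ B₃ := by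
    rintro z ⟨hz, hle⟩
    by_cases hz1 : z ∈ B₁
    · exact Or.inl (Or.inl hz1)
    by_cases hz2 : z ∈ B₂
    · exact Or.inl (Or.inr hz2)
    by_cases hz3 : z ∈ B₃
    · exact Or.inr hz3
    exfalso
    have h := hle.trans (shortFlightCount_le_chargedSums hz hε2 τ hℓ)
    rw [collisionPairSum_eq_finsum_ite (orbit_mem hz), collisionPairSum_eq_finsum_ite (orbit_mem hz),
      collisionPairSum_eq_finsum_ite (orbit_mem hz)] at h
    delta orbit at h
    beta_reduce at h
    simp only [hB₁def, hB₂def, hB₃def, mem_setOf_eq, not_and, not_le] at hz1 hz2 hz3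
    have h1 := hz1 hz
    have h2 := hz2 hz
    have h3 := hz3 hz
    linarith
  -- the three window bounds
  have hb₁ : P B₁ ≤ ENNReal.ofReal (48 * ℓ * ((N + 1 : ℕ) : ℝ) ^ 2 * hsDiameter σ N ^ 2 / y) * m₁ := by
    have h : P B₁ ≤ _ := localGibbsLaw_collisionMarkSum_ge_le hσ2 ha hθ u Φ hstat hpair htube hlift hℓ
      (b := fun _ : V3 × V3 => (1 : ℝ)) measurable_const (fun _ => zero_le_one) (by positivity : 0 < y / 3)
    refine h.trans (le_of_eq ?_)
    have hI : ∫⁻ p, ENNReal.ofReal (‖p.2 - p.1‖ * 1)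
        ∂((gaussMeasure u θ).prod (gaussMeasure u θ)) = m₁ := by
      simp only [mul_one]
      rfl
    rw [hI, ← ENNReal.ofReal_inv_of_pos (by positivity), ← mul_assoc, ← ENNReal.ofReal_mul (by positivity)]
    congr 1
    congr 1
    field_simp
    ring
  have hb₂ : P B₂ ≤ ENNReal.ofReal (192 * τ * ℓ * ((N + 1 : ℕ) : ℝ) ^ 2 * hsDiameter σ N ^ 2 / y) * m₂ := by
    have h : P B₂ ≤ _ := localGibbsLaw_collisionMarkSum_ge_le hσ2 ha hθ u Φ hstat hpair htube hlift hτ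
      (b := fun q : V3 × V3 => ‖q.2 - q.1‖ / ((1 / 2 - hsDiameter σ N) / ℓ)) (by fun_prop)
      (fun q => div_nonneg (norm_nonneg _) hR.le)
      (by positivity : 0 < y / 3)
    refine h.trans ?_
    have hI : ∫⁻ p, ENNReal.ofReal (‖p.2 - p.1‖ * (‖p.2 - p.1‖ / ((1 / 2 - hsDiameter σ N) / ℓ)))
        ∂((gaussMeasure u θ).prod (gaussMeasure u θ)) = m₂ * ENNReal.ofReal ((1 / 2 - hsDiameter σ N) / ℓ)⁻¹ := by
      rw [hm₂, ← lintegral_mul_const' _ _ ENNReal.ofReal_ne_top]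
      refine lintegral_congr fun p => ?_
      rw [← ENNReal.ofReal_mul (by positivity)]
      congr 1
      rw [div_eq_mul_inv, sq, mul_assoc]
    rw [hI, ← ENNReal.ofReal_inv_of_pos (by positivity), ← mul_assoc, ← mul_assoc,
      ← ENNReal.ofReal_mul (by positivity), mul_comm _ (ENNReal.ofReal ((1 / 2 - hsDiameter σ N) / ℓ)⁻¹), ← mul_assoc,
      ← ENNReal.ofReal_mul (by positivity)]
    refine mul_le_mul_of_nonneg_right (ENNReal.ofReal_le_ofReal ?_) bot_le
    have hRinv : ((1 / 2 - hsDiameter σ N) / ℓ)⁻¹ ≤ 4 * ℓ := by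
      rw [inv_div, div_le_iff₀ (by linarith)]
      nlinarith
    calc ((1 / 2 - hsDiameter σ N) / ℓ)⁻¹ * ((y / 3)⁻¹ * (16 * τ * ((N + 1 : ℕ) : ℝ) ^ 2 * hsDiameter σ N ^ 2))
        ≤ (4 * ℓ) * ((y / 3)⁻¹ * (16 * τ * ((N + 1 : ℕ) : ℝ) ^ 2 * hsDiameter σ N ^ 2)) :=
          mul_le_mul_of_nonneg_right hRinv (by positivity)
      _ = 192 * τ * ℓ * ((N + 1 : ℕ) : ℝ) ^ 2 * hsDiameter σ N ^ 2 / y := by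
          field_simp
          ring
  have hb₃ : P B₃ ≤ ENNReal.ofReal (1536 * τ * ℓ * ((N + 1 : ℕ) : ℝ) ^ 3 * hsDiameter σ N ^ 4 / y) * m₂ := by
    have h : P B₃ ≤ _ := localGibbsLaw_fwdHitCollisionSum_ge_le hσ2 ha hθ u Φ hstat htriple htube hlift hτ hℓ
      (by positivity : 0 < y / 6)
    refine h.trans (le_of_eq ?_)
    rw [← ENNReal.ofReal_inv_of_pos (by positivity), ← mul_assoc, ← ENNReal.ofReal_mul (by positivity)]
    congr 1
    congr 1
    field_simp
    ring
  calc P {z | z ∈ Φ.good ∧ y ≤ collisionPairSum (Torus.geometry (Fin 3)) (hsDiameter σ N) (orbit σ N Φ z)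
        (Icc 0 τ) (fun s i j => if s - ℓ < pairFlightStart σ N Φ z i j s then (1 : ℝ) else 0)}
      ≤ P (B₁ ∪ B₂ ∪ B₃) := measure_mono hsub
    _ ≤ P B₁ + P B₂ + P B₃ := (measure_union_le _ _).trans (add_le_add (measure_union_le _ _) le_rfl)
    _ ≤ ENNReal.ofReal (48 * ℓ * ((N + 1 : ℕ) : ℝ) ^ 2 * hsDiameter σ N ^ 2 / y) * m₁ +
          ENNReal.ofReal (192 * τ * ℓ * ((N + 1 : ℕ) : ℝ) ^ 2 * hsDiameter σ N ^ 2 / y) * m₂ +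
          ENNReal.ofReal (1536 * τ * ℓ * ((N + 1 : ℕ) : ℝ) ^ 3 * hsDiameter σ N ^ 4 / y) * m₂ :=
        add_le_add (add_le_add hb₁ hb₂) hb₃
    _ = ENNReal.ofReal (48 * ℓ * ((N + 1 : ℕ) : ℝ) ^ 2 * hsDiameter σ N ^ 2 / y) * m₁ +
          ENNReal.ofReal ((192 * τ * ℓ * ((N + 1 : ℕ) : ℝ) ^ 2 * hsDiameter σ N ^ 2 +
            1536 * τ * ℓ * ((N + 1 : ℕ) : ℝ) ^ 3 * hsDiameter σ N ^ 4) / y) * m₂ := by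
        rw [add_div, ENNReal.ofReal_add (by positivity) (by positivity), add_mul, add_assoc]

end Literature.MathematicalPhysics.KineticTheory

end
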